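import Mathlib
import Literature.Analysis.Convex.ConvexMetricProjection
import Literature.Analysis.Convex.SchauderFixedPoint
import HarnessLib

/-!
# Zeros of set-valued maps on compact convex sets (Aubin, *Optima and Equilibria*, Ch. 9)

Literature anchor for J.-P. Aubin, *Optima and Equilibria: An Introduction to Nonlinear Analysis*,
GTM 140, Springer 1993 (2nd ed. 1998) [Aubin1993], Chapter 9 "Solution of Nonlinear Equations and
Inclusions": the **General Equilibrium Theorem** (zeros of set-valued maps satisfying the tangential
condition on a convex compact set), Kakutani's and the Kakutani–Fan fixed point theorems as its
corollaries, and the single-valued variational inequality that drives the proof. `X` is a real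
Hilbert space (here: a complete real inner product space `E`), `K ⊆ X` convex and compact.

* `exists_inner_sub_le_zero` — **variational inequality** (Hartman–Stampacchia; the single-valued case
  of Thm 9.9, p. 157): for `w` continuous on `K` there is `x̄ ∈ K` with `⟪w x̄, y - x̄⟫ ≤ 0` for all
  `y ∈ K`, i.e. `w x̄ ∈ N_K(x̄)` (Schauder/Brouwer applied to `x ↦ P_K(x + w x)` and the variational
  characterisation of the metric projection `P_K`, both in the tree).
* `exists_continuous_margin` — the separation / partition-of-unity device of the proof of Thm 9.3
  (pp. 151–152, steps (c)–(d)): if no value contains `0`, a continuous `w` and a margin `m > 0` with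
  `⟪w x, c⟫ ≥ m x` on `C x`.
* `exists_zero_mem_of_dual_tangential_support` — **Thm 9.3 (a)** with `A = 1` in the generality of
  its proof: `C` *upper hemicontinuous in Aubin's sense* (the support functions `x ↦ σ(C x, p)` are
  upper semicontinuous — stated here without `sSup` as hypothesis `hC`), closed convex values, and
  the **dual tangential condition** (17) `∀ x ∈ K, ∀ p ∈ N_K(x), σ(C x, -p) ≥ 0` (stated as: for every
  `ε > 0` some `c ∈ C x` has `⟪p, c⟫ < ε`) `⟹ ∃ x̄ ∈ K, 0 ∈ C x̄`.
* `support_of_upperHemicontinuousOn`, `support_translate` — Mathlib's (topological) upper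
  hemicontinuity `UpperHemicontinuousOn` implies Aubin's, and Aubin's is stable under adding a
  continuous single-valued map (used for Cor 9.1 / Thm 9.4 (b) / Thm 9.5).
* `exists_zero_mem_of_dual_tangential` — Thm 9.3 (a) (`A = 1`) for `UpperHemicontinuousOn` maps.
* `dual_of_tangential` — **Prop 9.4 (a)**: the tangential condition implies the dual one; the
  tangent cone `T_K(x)` of the convex set `K` is written as the closure of the cone of feasible
  directions, `closure {d | ∃ h > 0, x + h • d ∈ K}` (the Ch. 4 description of `T_K` for convex
  `K`; Mathlib has no named tangent cone of a convex set, `posTangentConeAt` being the calculus notion).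
* `exists_zero_mem_of_tangential` — **Thm 9.4 (a), the General Equilibrium Theorem**;
  `exists_eq_sub_of_tangential` — **Thm 9.4 (b)** (`∀ y ∈ K, ∃ x̂ ∈ K, y ∈ x̂ - C x̂`).
* `exists_mem_self_of_reentrant` — **Thm 9.6 (Kakutani–Fan)**: a re-entrant
  (`D x ∩ (x + T_K(x)) ≠ ∅`) upper hemicontinuous `D : K ⇉ X` with nonempty closed convex values has
  a fixed point; `exists_mem_self` — **Thm 9.5 (Kakutani)**: the case `D x ⊆ K`.

All statements are for Mathlib's `UpperHemicontinuousOn` (upper semicontinuity of the set-valued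
map), which implies Aubin's weaker support-function hemicontinuity (`support_of_upperHemicontinuousOn`);
the core theorem `exists_zero_mem_of_dual_tangential_support` is kept at Aubin's generality. Infinite
dimension is allowed throughout (`K` compact). Related tree files: `CellinaSelection.lean` /
Borwein–Lewis §8.2 (Kakutani–Fan in Euclidean space, named facts), `SchauderFixedPoint.lean`,
`ConvexMetricProjection.lean` (Deutsch). Everything is proved; no definitions, no named facts, no
`sorry`.
-/

open Set Metric Filter Topology
open scoped RealInnerProductSpace

namespace Literature.Analysis.Convex.SetValuedEquilibria

variable {E : Type*} [NormedAddCommGroup E] [InnerProductSpace ℝ E]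

/-! ## The variational inequality for a continuous single-valued field -/

/-- **Variational inequality on a compact convex set** (Hartman–Stampacchia; Aubin Thm 9.9 in the
single-valued case): if `K` is nonempty, compact and convex and `w` is continuous on `K`, there is
`x̄ ∈ K` with `⟪w x̄, y - x̄⟫ ≤ 0` for every `y ∈ K` (that is, `w x̄ ∈ N_K(x̄)`). Proof: a fixed point
`x̄ = P_K(x̄ + w x̄)` (Schauder's theorem `exists_fixedPoint_of_mapsTo_isCompact`, `P_K` the metric
projection of `ConvexMetricProjection`) satisfies the variational characterisation
`⟪(x̄ + w x̄) - x̄, y - x̄⟫ ≤ 0` (`inner_sub_proj_le_zero`, Deutsch Thm 4.1).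
[cite: Aubin1993, Thm 9.9 (single-valued case)] -/
theorem exists_inner_sub_le_zero {K : Set E} (hKc : IsCompact K) (hKconv : Convex ℝ K)
    (hKne : K.Nonempty) {w : E → E} (hw : ContinuousOn w K) :
    ∃ x ∈ K, ∀ y ∈ K, ⟪w x, y - x⟫ ≤ 0 := by
  have hcpl : IsComplete K := hKc.isComplete
  set g : E → E := fun x => ConvexMetricProjection.proj K (x + w x) with hg
  have hgc : ContinuousOn g K :=
    (ConvexMetricProjection.continuous_proj hKne hcpl hKconv).comp_continuousOn
      (continuousOn_id.add hw)
  have hmaps : MapsTo g K K := fun x _ => ConvexMetricProjection.proj_mem hKne hcpl hKconv _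
  obtain ⟨x, hx, hgx⟩ :=
    exists_fixedPoint_of_mapsTo_isCompact hKconv hKc.isClosed hKne hKc hgc hmaps hmaps
  refine ⟨x, hx, fun y hy => ?_⟩
  have hvi := ConvexMetricProjection.inner_sub_proj_le_zero hKne hcpl hKconv (x + w x) hy
  have hgx' : ConvexMetricProjection.proj K (x + w x) = x := hgx
  rwa [hgx', add_sub_cancel_left] at hvi
#harness_tags exists_inner_sub_le_zero

/-! ## Aubin's support-function hemicontinuity -/

/-- Mathlib's upper hemicontinuity (for every open `U ⊇ C x`, `C x' ⊆ U` for `x'` near `x` in `K`)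
implies Aubin's (Def. 9.1: upper semicontinuity of the support functions `x ↦ σ(C x, p)`; Prop 9.1),
in the `sSup`-free form used below: if `⟪p, ·⟫ ≤ t' < t` on `C x` then `⟪p, ·⟫ < t` on `C x'` for
`x'` near `x`. [cite: Aubin1993, Prop 9.1] -/
theorem support_of_upperHemicontinuousOn {X : Type*} [TopologicalSpace X] {K : Set X}
    {C : X → Set E} (hC : UpperHemicontinuousOn C K) :
    ∀ p : E, ∀ x ∈ K, ∀ t : ℝ, (∃ t' < t, ∀ c ∈ C x, ⟪p, c⟫ ≤ t') →
      ∀ᶠ x' in 𝓝[K] x, ∀ c ∈ C x', ⟪p, c⟫ < t := by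
  intro p x hx t ⟨t', ht', hle⟩
  have hopen : IsOpen {c : E | ⟪p, c⟫ < t} :=
    isOpen_lt (continuous_const.inner continuous_id) continuous_const
  have hsub : C x ⊆ {c : E | ⟪p, c⟫ < t} := fun c hc => (hle c hc).trans_lt ht'
  exact ((upperHemicontinuousOn_iff_forall_isOpen.1 hC) x hx _ hopen hsub).mono
    fun x' hx' c hc => hx' hc
#harness_tags support_of_upperHemicontinuousOn

/-- Aubin's hemicontinuity is stable under adding a continuous single-valued map: if `C` has upper
semicontinuous support functions on `K` and `a` is continuous on `K`, so has `x ↦ a x + C x`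
(`σ(a x + C x, p) = ⟪p, a x⟫ + σ(C x, p)`). Used for Cor 9.1 / Thm 9.4 (b) (`y - x + C x`) and for
Thm 9.5/9.6 (`D x - x`). [cite: Aubin1993, Cor 9.1 (hemicontinuity part)] -/
theorem support_translate {K : Set E} {C : E → Set E}
    (hC : ∀ p : E, ∀ x ∈ K, ∀ t : ℝ, (∃ t' < t, ∀ c ∈ C x, ⟪p, c⟫ ≤ t') →
      ∀ᶠ x' in 𝓝[K] x, ∀ c ∈ C x', ⟪p, c⟫ < t)
    {a : E → E} (ha : ContinuousOn a K) :
    ∀ p : E, ∀ x ∈ K, ∀ t : ℝ, (∃ t' < t, ∀ c ∈ (fun c => a x + c) '' C x, ⟪p, c⟫ ≤ t') →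
      ∀ᶠ x' in 𝓝[K] x, ∀ c ∈ (fun c => a x' + c) '' C x', ⟪p, c⟫ < t := by
  intro p x hx t ⟨t', ht', hle⟩
  -- `⟪p, c⟫ ≤ t' - ⟪p, a x⟫` on `C x`
  have hle' : ∀ c ∈ C x, ⟪p, c⟫ ≤ t' - ⟪p, a x⟫ := fun c hc => by
    have := hle (a x + c) ⟨c, hc, rfl⟩
    rw [inner_add_right] at this
    linarith
  set t'' : ℝ := (t' + t) / 2 with ht''
  have h1 : t' < t'' := by rw [ht'']; linarith
  have h2 : t'' < t := by rw [ht'']; linarith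
  have hev1 : ∀ᶠ x' in 𝓝[K] x, ∀ c ∈ C x', ⟪p, c⟫ < t'' - ⟪p, a x⟫ :=
    hC p x hx _ ⟨t' - ⟪p, a x⟫, by linarith, hle'⟩
  have hcont : Tendsto (fun x' => ⟪p, a x'⟫) (𝓝[K] x) (𝓝 ⟪p, a x⟫) :=
    ((continuous_const.inner continuous_id : Continuous fun q : E => ⟪p, q⟫).tendsto (a x)).comp
      (ha x hx)
  have hev2 : ∀ᶠ x' in 𝓝[K] x, ⟪p, a x'⟫ < ⟪p, a x⟫ + (t - t'') :=
    hcont.eventually_lt_const (by linarith)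
  filter_upwards [hev1, hev2] with x' h1' h2'
  rintro c ⟨c₀, hc₀, rfl⟩
  rw [inner_add_right]
  have := h1' c₀ hc₀
  linarith
#harness_tags support_translate

/-! ## Separation and a partition of unity (proof of Thm 9.3, steps (c)–(d)) -/

/-- **Gluing strictly separating directions with a margin.** `K` compact in a metric space, `C`
with upper semicontinuous support functions on `K` (Aubin's hemicontinuity) and closed convex values
none of which contains `0`: there are a continuous `w : X → E` and `m : X → ℝ`, `m > 0` on `K`, with
`⟪w x, c⟫ ≥ m x` for `x ∈ K`, `c ∈ C x`. (Strict separation `⟪p_x, ·⟫ > u_x > 0` on `C x`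
(`geometric_hahn_banach_point_closed`, Riesz representation), valid with margin `u_x / 2` on `C z`
for `z ∈ K` near `x` by hemicontinuity; a finite subcover and the partition of unity
`max 0 (δ_i - dist z x_i)`; Aubin, proof of Thm 9.3 (c), (d), p. 151.)
[cite: Aubin1993, Thm 9.3 (proof, steps (c)–(d))] -/
theorem exists_continuous_margin {X : Type*} [MetricSpace X] [CompleteSpace E] {K : Set X}
    (hK : IsCompact K) {C : X → Set E}
    (hC : ∀ p : E, ∀ x ∈ K, ∀ t : ℝ, (∃ t' < t, ∀ c ∈ C x, ⟪p, c⟫ ≤ t') →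
      ∀ᶠ x' in 𝓝[K] x, ∀ c ∈ C x', ⟪p, c⟫ < t)
    (hcl : ∀ x ∈ K, IsClosed (C x)) (hconv : ∀ x ∈ K, Convex ℝ (C x))
    (h0 : ∀ x ∈ K, (0 : E) ∉ C x) :
    ∃ w : X → E, ∃ m : X → ℝ, Continuous w ∧ (∀ x ∈ K, 0 < m x) ∧
      ∀ x ∈ K, ∀ c ∈ C x, m x ≤ ⟪w x, c⟫ := by
  classical
  -- strictly separating vectors with a margin, valid on `C z` for `z ∈ K` near `x`
  have hsep : ∀ x, ∃ p : E, ∃ δ : ℝ, ∃ u : ℝ, 0 < δ ∧ 0 < u ∧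
      (x ∈ K → ∀ z ∈ K, dist z x < δ → ∀ c ∈ C z, u ≤ ⟪p, c⟫) := by
    intro x
    by_cases hx : x ∈ K
    · obtain ⟨f, s, hs0, hsC⟩ :=
        geometric_hahn_banach_point_closed (hconv x hx) (hcl x hx) (h0 x hx)
      have hs : 0 < s := by simpa using hs0
      set p : E := (InnerProductSpace.toDual ℝ E).symm f with hp
      have hpf : ∀ c, ⟪p, c⟫ = f c := fun c => by rw [hp, InnerProductSpace.toDual_symm_apply]
      -- hemicontinuity applied to `-p` with `t' = -s`, `t = -s/2`
      have hev : ∀ᶠ z in 𝓝[K] x, ∀ c ∈ C z, ⟪-p, c⟫ < -(s / 2) :=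
        hC (-p) x hx _ ⟨-s, by linarith, fun c hc => by
          rw [inner_neg_left, hpf]; exact neg_le_neg (hsC c hc).le⟩
      obtain ⟨δ, hδ, hδU⟩ := Metric.mem_nhdsWithin_iff.1 hev
      refine ⟨p, δ, s / 2, hδ, by linarith, fun _ z hz hzx c hc => ?_⟩
      have := hδU ⟨mem_ball.2 hzx, hz⟩ c hc
      rw [inner_neg_left] at this
      linarith
    · exact ⟨0, 1, 1, one_pos, one_pos, fun h => absurd h hx⟩
  choose p δ u hδpos hupos hple using hsep
  -- a finite subcover of `K` by the balls `ball x (δ x)`, centres in `K`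
  obtain ⟨t, htK, hcover⟩ := hK.elim_nhds_subcover (fun x => ball x (δ x))
    (fun x _ => ball_mem_nhds x (hδpos x))
  have hcov : ∀ z ∈ K, ∃ c ∈ t, dist z c < δ c := fun z hz => by
    simpa only [mem_iUnion, mem_ball, exists_prop] using hcover hz
  -- partition-of-unity weights, the glued field and its margin
  set wt : X → X → ℝ := fun i z => max 0 (δ i - dist z i) with hwt
  have hwt_nonneg : ∀ i z, 0 ≤ wt i z := fun i z => le_max_left _ _
  have hwt_cont : ∀ i, Continuous (wt i) := fun i =>
    continuous_const.max (continuous_const.sub (continuous_id.dist continuous_const))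
  have hwt_pos_iff : ∀ i z, 0 < wt i z ↔ dist z i < δ i := fun i z => by
    simp only [hwt, lt_max_iff, lt_self_iff_false, false_or, sub_pos]
  refine ⟨fun z => ∑ i ∈ t, wt i z • p i, fun z => ∑ i ∈ t, wt i z * u i,
    continuous_finsetSum _ fun i _ => (hwt_cont i).smul continuous_const, fun z hz => ?_,
    fun z hz c hc => ?_⟩
  · obtain ⟨i₀, hi₀t, hzi₀⟩ := hcov z hz
    exact Finset.sum_pos' (fun i _ => mul_nonneg (hwt_nonneg i z) (hupos i).le)
      ⟨i₀, hi₀t, mul_pos ((hwt_pos_iff i₀ z).2 hzi₀) (hupos i₀)⟩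
  · rw [sum_inner]
    simp only [real_inner_smul_left]
    refine Finset.sum_le_sum fun i hi => ?_
    rcases (hwt_nonneg i z).eq_or_lt with h0 | hpos
    · rw [← h0, zero_mul, zero_mul]
    · exact mul_le_mul_of_nonneg_left
        (hple i (htK i hi) z hz ((hwt_pos_iff i z).1 hpos) c hc) hpos.le
#harness_tags exists_continuous_margin

/-! ## Theorem 9.3 (a) / 9.4: zeros under the (dual) tangential condition -/

section Zeros

variable [CompleteSpace E]

/-- **Aubin Thm 9.3 (a) (`A = 1`), in the generality of its proof.** `K` nonempty compact convex in a
Hilbert space; `C : K ⇉ X` with upper semicontinuous support functions (hypothesis `hC`, Aubin's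
"upper hemi-continuity"), closed convex values, satisfying the **dual tangential condition** (17):
for `x ∈ K` and every normal vector `p ∈ N_K(x)` (`⟪p, y - x⟫ ≤ 0` on `K`), `σ(C x, -p) ≥ 0`, i.e.
`⟪p, ·⟫` takes values `< ε` on `C x` for every `ε > 0`. Then `C` has a zero in `K`. Proof (by
contradiction, p. 151–152): `exists_continuous_margin` gives `w`, `m`; the variational inequality
`exists_inner_sub_le_zero` (in place of Ky Fan's inequality, Thm 8.6) gives `x̄` with
`w x̄ ∈ N_K(x̄)`; the dual condition at `(x̄, w x̄)` with `ε = m x̄` contradicts the margin.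
[cite: Aubin1993, Thm 9.3 (a) (A = 1, dual tangential condition (17))] -/
theorem exists_zero_mem_of_dual_tangential_support {K : Set E} (hKc : IsCompact K)
    (hKconv : Convex ℝ K) (hKne : K.Nonempty) {C : E → Set E}
    (hC : ∀ p : E, ∀ x ∈ K, ∀ t : ℝ, (∃ t' < t, ∀ c ∈ C x, ⟪p, c⟫ ≤ t') →
      ∀ᶠ x' in 𝓝[K] x, ∀ c ∈ C x', ⟪p, c⟫ < t)
    (hcl : ∀ x ∈ K, IsClosed (C x)) (hconv : ∀ x ∈ K, Convex ℝ (C x))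
    (hdual : ∀ x ∈ K, ∀ p : E, (∀ y ∈ K, ⟪p, y - x⟫ ≤ 0) →
      ∀ ε : ℝ, 0 < ε → ∃ c ∈ C x, ⟪p, c⟫ < ε) :
    ∃ x ∈ K, (0 : E) ∈ C x := by
  by_contra H
  push Not at H
  obtain ⟨w, m, hw, hm, hle⟩ := exists_continuous_margin hKc hC hcl hconv H
  obtain ⟨x, hx, hvi⟩ := exists_inner_sub_le_zero hKc hKconv hKne hw.continuousOn
  obtain ⟨c, hc, hlt⟩ := hdual x hx (w x) hvi (m x) (hm x hx)
  exact absurd (hle x hx c hc) (not_le.2 hlt)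
#harness_tags exists_zero_mem_of_dual_tangential_support

/-- **Aubin Thm 9.3 (a) (`A = 1`) for upper hemicontinuous maps** (Mathlib's `UpperHemicontinuousOn`):
nonempty compact convex `K`, `C` upper hemicontinuous on `K` with closed convex values, dual
tangential condition `⟹` `0 ∈ C x̄` for some `x̄ ∈ K`.
[cite: Aubin1993, Thm 9.3 (a) (A = 1, dual tangential condition (17); USC maps)] -/
theorem exists_zero_mem_of_dual_tangential {K : Set E} (hKc : IsCompact K) (hKconv : Convex ℝ K)
    (hKne : K.Nonempty) {C : E → Set E} (hC : UpperHemicontinuousOn C K)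
    (hcl : ∀ x ∈ K, IsClosed (C x)) (hconv : ∀ x ∈ K, Convex ℝ (C x))
    (hdual : ∀ x ∈ K, ∀ p : E, (∀ y ∈ K, ⟪p, y - x⟫ ≤ 0) →
      ∀ ε : ℝ, 0 < ε → ∃ c ∈ C x, ⟪p, c⟫ < ε) :
    ∃ x ∈ K, (0 : E) ∈ C x :=
  exists_zero_mem_of_dual_tangential_support hKc hKconv hKne (support_of_upperHemicontinuousOn hC)
    hcl hconv hdual
#harness_tags exists_zero_mem_of_dual_tangential

omit [CompleteSpace E] in
/-- **Aubin Prop 9.4 (a)** (`A = 1`): the tangential condition `C x ∩ T_K(x) ≠ ∅` implies the dual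
tangential condition. Here `T_K(x)`, the tangent cone of the convex set `K` at `x`, is the closure
of the cone of feasible directions `{d | ∃ h > 0, x + h • d ∈ K}` (Ch. 4), and a normal vector
`p ∈ N_K(x)` pairs nonpositively with it. [cite: Aubin1993, Prop 9.4 (a)] -/
theorem dual_of_tangential {K : Set E} {C : E → Set E}
    (htan : ∀ x ∈ K, ∃ c ∈ C x, c ∈ closure {d : E | ∃ h : ℝ, 0 < h ∧ x + h • d ∈ K}) :
    ∀ x ∈ K, ∀ p : E, (∀ y ∈ K, ⟪p, y - x⟫ ≤ 0) →
      ∀ ε : ℝ, 0 < ε → ∃ c ∈ C x, ⟪p, c⟫ < ε := by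
  intro x hx p hp ε hε
  obtain ⟨c, hc, hcT⟩ := htan x hx
  refine ⟨c, hc, lt_of_le_of_lt ?_ hε⟩
  have hclosed : IsClosed {d : E | ⟪p, d⟫ ≤ 0} :=
    isClosed_le (continuous_const.inner continuous_id) continuous_const
  have hsub : {d : E | ∃ h : ℝ, 0 < h ∧ x + h • d ∈ K} ⊆ {d : E | ⟪p, d⟫ ≤ 0} := by
    rintro d ⟨h, hh, hd⟩
    have := hp _ hd
    rw [add_sub_cancel_left, real_inner_smul_right] at this
    exact le_of_mul_le_mul_left (by rwa [mul_zero]) hh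
  exact closure_minimal hsub hclosed hcT
#harness_tags dual_of_tangential

/-- **Aubin Thm 9.4 (a) — the General Equilibrium Theorem.** `X` a Hilbert space, `K ⊆ X` nonempty
convex compact, `C : K ⇉ X` upper hemicontinuous with nonempty closed convex values satisfying the
tangential condition `∀ x ∈ K, C x ∩ T_K(x) ≠ ∅` (27) `⟹ ∃ x̄ ∈ K, 0 ∈ C x̄`. ("An equivalent
version of the 1910 Brouwer Fixed Point Theorem", p. 153.) [cite: Aubin1993, Thm 9.4 (a)] -/
theorem exists_zero_mem_of_tangential {K : Set E} (hKc : IsCompact K) (hKconv : Convex ℝ K)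
    (hKne : K.Nonempty) {C : E → Set E} (hC : UpperHemicontinuousOn C K)
    (hcl : ∀ x ∈ K, IsClosed (C x)) (hconv : ∀ x ∈ K, Convex ℝ (C x))
    (htan : ∀ x ∈ K, ∃ c ∈ C x, c ∈ closure {d : E | ∃ h : ℝ, 0 < h ∧ x + h • d ∈ K}) :
    ∃ x ∈ K, (0 : E) ∈ C x :=
  exists_zero_mem_of_dual_tangential hKc hKconv hKne hC hcl hconv (dual_of_tangential htan)
#harness_tags exists_zero_mem_of_tangential

/-- **Aubin Thm 9.4 (b).** Under the hypotheses of the General Equilibrium Theorem, every `y ∈ K` is of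
the form `y = x̂ - c` with `x̂ ∈ K`, `c ∈ C x̂` (`y ∈ x̂ - C x̂`): apply (a) to `x ↦ C x - x + y`, which
inherits hemicontinuity (`support_translate`) and the dual tangential condition (Cor 9.1:
`⟪p, y - x⟫ ≤ 0` for `p ∈ N_K(x)`). [cite: Aubin1993, Thm 9.4 (b)] -/
theorem exists_eq_sub_of_tangential {K : Set E} (hKc : IsCompact K) (hKconv : Convex ℝ K)
    {C : E → Set E} (hC : UpperHemicontinuousOn C K)
    (hcl : ∀ x ∈ K, IsClosed (C x)) (hconv : ∀ x ∈ K, Convex ℝ (C x))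
    (htan : ∀ x ∈ K, ∃ c ∈ C x, c ∈ closure {d : E | ∃ h : ℝ, 0 < h ∧ x + h • d ∈ K})
    {y : E} (hy : y ∈ K) : ∃ x ∈ K, ∃ c ∈ C x, y = x - c := by
  have hdual := dual_of_tangential htan
  set C' : E → Set E := fun x => (fun c => (y - x) + c) '' C x with hC'
  have ha : ContinuousOn (fun x : E => y - x) K := (continuousOn_const.sub continuousOn_id)
  have hC's := support_translate (support_of_upperHemicontinuousOn hC) ha
  have hcl' : ∀ x ∈ K, IsClosed (C' x) := fun x hx => by
    have : C' x = (Homeomorph.addLeft (y - x)) '' C x := rfl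
    rw [this, Homeomorph.isClosed_image]
    exact hcl x hx
  have hconv' : ∀ x ∈ K, Convex ℝ (C' x) := fun x hx => (hconv x hx).translate (y - x)
  have hdual' : ∀ x ∈ K, ∀ p : E, (∀ z ∈ K, ⟪p, z - x⟫ ≤ 0) →
      ∀ ε : ℝ, 0 < ε → ∃ c ∈ C' x, ⟪p, c⟫ < ε := by
    intro x hx p hp ε hε
    obtain ⟨c, hc, hlt⟩ := hdual x hx p hp ε hε
    refine ⟨(y - x) + c, ⟨c, hc, rfl⟩, ?_⟩
    rw [inner_add_right]
    have := hp y hy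
    linarith
  obtain ⟨x, hx, h0⟩ :=
    exists_zero_mem_of_dual_tangential_support hKc hKconv ⟨y, hy⟩ hC's hcl' hconv' hdual'
  obtain ⟨c, hc, hc0⟩ := h0
  refine ⟨x, hx, c, hc, ?_⟩
  have : y - x + c = 0 := hc0
  rw [← sub_eq_zero]
  rw [← this]
  abel
#harness_tags exists_eq_sub_of_tangential

/-! ## Theorems 9.5 and 9.6: Kakutani and Kakutani–Fan -/

/-- **Aubin Thm 9.6 (Kakutani–Fan).** `K ⊆ X` nonempty convex compact, `D : K ⇉ X` upper
hemicontinuous with nonempty closed convex values and **re-entrant**: `D x ∩ (x + T_K(x)) ≠ ∅` for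
all `x ∈ K` (29). Then `D` has a fixed point `x⋆ ∈ D x⋆`. (Apply Thm 9.3 (a) to `x ↦ D x - x`.)
[cite: Aubin1993, Thm 9.6] -/
theorem exists_mem_self_of_reentrant {K : Set E} (hKc : IsCompact K) (hKconv : Convex ℝ K)
    (hKne : K.Nonempty) {D : E → Set E} (hD : UpperHemicontinuousOn D K)
    (hcl : ∀ x ∈ K, IsClosed (D x)) (hconv : ∀ x ∈ K, Convex ℝ (D x))
    (hre : ∀ x ∈ K, ∃ d ∈ D x, d - x ∈ closure {v : E | ∃ h : ℝ, 0 < h ∧ x + h • v ∈ K}) :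
    ∃ x ∈ K, x ∈ D x := by
  set C : E → Set E := fun x => (fun d => (-x) + d) '' D x with hCdef
  have ha : ContinuousOn (fun x : E => -x) K := continuous_neg.continuousOn
  have hCs := support_translate (support_of_upperHemicontinuousOn hD) ha
  have hcl' : ∀ x ∈ K, IsClosed (C x) := fun x hx => by
    have : C x = (Homeomorph.addLeft (-x)) '' D x := rfl
    rw [this, Homeomorph.isClosed_image]
    exact hcl x hx
  have hconv' : ∀ x ∈ K, Convex ℝ (C x) := fun x hx => (hconv x hx).translate (-x)
  -- the tangential condition for `D x - x`, hence the dual one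
  have htan : ∀ x ∈ K, ∃ c ∈ C x, c ∈ closure {v : E | ∃ h : ℝ, 0 < h ∧ x + h • v ∈ K} := by
    intro x hx
    obtain ⟨d, hd, hdT⟩ := hre x hx
    exact ⟨-x + d, ⟨d, hd, rfl⟩, by rwa [neg_add_eq_sub]⟩
  obtain ⟨x, hx, h0⟩ :=
    exists_zero_mem_of_dual_tangential_support hKc hKconv hKne hCs hcl' hconv' (dual_of_tangential htan)
  obtain ⟨d, hd, hd0⟩ := h0
  refine ⟨x, hx, ?_⟩
  have : -x + d = 0 := hd0
  have hxd : x = d := neg_add_eq_zero.1 this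
  rw [← hxd] at hd
  exact hd
#harness_tags exists_mem_self_of_reentrant

/-- **Aubin Thm 9.5 (Kakutani).** `K ⊆ X` nonempty convex compact, `D : K ⇉ K` upper hemicontinuous
with nonempty closed convex values `D x ⊆ K` `⟹` `D` has a fixed point. (`D x - x ⊆ K - x ⊆ T_K(x)`,
so `D` is re-entrant.) Infinite-dimensional `X` is allowed (the topological input is Schauder's
theorem); compare `Literature.Analysis.Convex.BorweinLewis2000_kakutaniFan` (Euclidean space).
[cite: Aubin1993, Thm 9.5] -/
theorem exists_mem_self {K : Set E} (hKc : IsCompact K) (hKconv : Convex ℝ K) (hKne : K.Nonempty)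
    {D : E → Set E} (hD : UpperHemicontinuousOn D K) (hne : ∀ x ∈ K, (D x).Nonempty)
    (hcl : ∀ x ∈ K, IsClosed (D x)) (hconv : ∀ x ∈ K, Convex ℝ (D x))
    (hsub : ∀ x ∈ K, D x ⊆ K) : ∃ x ∈ K, x ∈ D x := by
  refine exists_mem_self_of_reentrant hKc hKconv hKne hD hcl hconv fun x hx => ?_
  obtain ⟨d, hd⟩ := hne x hx
  refine ⟨d, hd, subset_closure ⟨1, one_pos, ?_⟩⟩
  rw [one_smul, add_sub_cancel]
  exact hsub x hx hd
#harness_tags exists_mem_self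

end Zeros

end Literature.Analysis.Convex.SetValuedEquilibria
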